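import Literature.Algebra.Polynomial.CasasAlvero.Degree7CharP
import Literature.Algebra.Polynomial.CasasAlvero.Degree5CharP
import Literature.Algebra.Polynomial.CasasAlvero.PrimePowSuccCounterexample
import Literature.Algebra.Polynomial.CasasAlvero.SmallDegreesSummary
import Literature.Algebra.Polynomial.CasasAlvero.FieldCorollaries
import Mathlib.Tactic.NormNum.Prime
import HarnessLib

/-!
# Casas-Alvero in small characteristic: the complete picture for degrees `d ≤ 7`

Over ANY field `K` of characteristic `p ∈ {2, 3, 5, 7, 11}` the truth value of `CA_d(K)` for every `d ≤ 7` (and `d = 8` in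
characteristic 2), assembled from the files of this directory:

* char 2: `CA_d(K)` iff `d ∈ {0, 1, 2, 4, 8}` (`d ≤ 8`);
* char 3: iff `d ∈ {0, 1, 2, 3, 6}`;   * char 5: iff `d ∈ {0, 1, 2, 3, 5}`;   * char 7: iff `d ∈ {0, 1, 2, 3, 7}`;
* char 11: iff `d ∈ {0, 1, 2, 3, 4}`.

Positive entries: prime powers and `2·pᵏ` (GvBLSW Props. 2, 6 + descent) and degrees `≤ 4` with `2,3,5,7 ≠ 0`; negative entries: the explicit
counterexamples (`p + 1`, `pᵏ + 1`, degree-4/5/6/7 bad primes) and the multiplicative transfer `¬CA_n ⇒ ¬CA_{n pᵏ}`.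
[cite: GrafVonBothmerEtAl2007, Props. 2, 6, 7] [cite: CastryckLaterveerOunaies2012, Thm. 4]
-/

noncomputable section

open Polynomial

namespace Literature.Algebra.Polynomial.CasasAlvero

variable (K : Type*) [Field K]

/-- Characteristic 2, `d ≤ 8`: `CA_d(K) ↔ d ∈ {0,1,2,4,8}`. [cite: GrafVonBothmerEtAl2007, Props. 2, 7] -/
theorem holdsInDegree_iff_of_char_two [CharP K 2] {d : ℕ} (hd : d ≤ 8) :
    HoldsInDegree K d ↔ d ∈ ({0, 1, 2, 4, 8} : Finset ℕ) := by
  have h2 : (2 : K) = 0 := by simpa using CharP.cast_eq_zero K 2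
  interval_cases d
  · exact iff_of_true (holdsInDegree_zero K) (by decide)
  · exact iff_of_true (holdsInDegree_one (R := K)) (by decide)
  · exact iff_of_true (holdsInDegree_two (R := K)) (by decide)
  · exact iff_of_false (fun h => (holdsInDegree_three_iff (K := K)).mp h h2) (by decide)
  · exact iff_of_true (holdsInDegree_four_of_char_two (K := K)) (by decide)
  · exact iff_of_false (not_holdsInDegree_five_of_char_two K) (by decide)
  · exact iff_of_false (by simpa using not_holdsInDegree_three_mul_two_pow (K := K) 1) (by decide)
  · exact iff_of_false (not_holdsInDegree_seven_of_charP (K := K) 2 (by norm_num)) (by decide)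
  · exact iff_of_true (by simpa using holdsInDegree_prime_pow_field K 2 3) (by decide)

/-- Characteristic 3, `d ≤ 7`: `CA_d(K) ↔ d ∈ {0,1,2,3,6}`. [cite: GrafVonBothmerEtAl2007, Props. 2, 6, 7] -/
theorem holdsInDegree_iff_of_char_three [CharP K 3] {d : ℕ} (hd : d ≤ 7) :
    HoldsInDegree K d ↔ d ∈ ({0, 1, 2, 3, 6} : Finset ℕ) := by
  interval_cases d
  · exact iff_of_true (holdsInDegree_zero K) (by decide)
  · exact iff_of_true (holdsInDegree_one (R := K)) (by decide)
  · exact iff_of_true (holdsInDegree_two (R := K)) (by decide)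
  · exact iff_of_true (by simpa using holdsInDegree_prime_pow_field K 3 1) (by decide)
  · exact iff_of_false (not_holdsInDegree_four_of_char_three (K := K)) (by decide)
  · exact iff_of_false (not_holdsInDegree_five_of_char_three (K := K)) (by decide)
  · exact iff_of_true (by simpa using holdsInDegree_two_mul_prime_pow_field K 3 1) (by decide)
  · exact iff_of_false (not_holdsInDegree_seven_of_charP (K := K) 3 (by norm_num)) (by decide)

/-- Characteristic 5, `d ≤ 7`: `CA_d(K) ↔ d ∈ {0,1,2,3,5}`. [cite: GrafVonBothmerEtAl2007, Props. 2, 7] -/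
theorem holdsInDegree_iff_of_char_five [CharP K 5] {d : ℕ} (hd : d ≤ 7) :
    HoldsInDegree K d ↔ d ∈ ({0, 1, 2, 3, 5} : Finset ℕ) := by
  haveI : Fact (Nat.Prime 5) := ⟨by norm_num⟩
  have h5 : (5 : K) = 0 := by simpa using CharP.cast_eq_zero K 5
  have h6 : (6 : K) ≠ 0 := by
    rw [show (6 : K) = 5 + 1 by norm_num, h5, zero_add]; exact one_ne_zero
  interval_cases d
  · exact iff_of_true (holdsInDegree_zero K) (by decide)
  · exact iff_of_true (holdsInDegree_one (R := K)) (by decide)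
  · exact iff_of_true (holdsInDegree_two (R := K)) (by decide)
  · exact iff_of_true (holdsInDegree_three (K := K) h6) (by decide)
  · exact iff_of_false (not_holdsInDegree_four_of_char_five (K := K)) (by decide)
  · exact iff_of_true (by simpa using holdsInDegree_prime_pow_field K 5 1) (by decide)
  · exact iff_of_false (not_holdsInDegree_prime_succ K 5) (by decide)
  · exact iff_of_false (not_holdsInDegree_seven_of_charP (K := K) 5 (by norm_num)) (by decide)

/-- Characteristic 7, `d ≤ 7`: `CA_d(K) ↔ d ∈ {0,1,2,3,7}`. [cite: CastryckLaterveerOunaies2012, Thm. 4] -/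
theorem holdsInDegree_iff_of_char_seven [CharP K 7] {d : ℕ} (hd : d ≤ 7) :
    HoldsInDegree K d ↔ d ∈ ({0, 1, 2, 3, 7} : Finset ℕ) := by
  haveI : Fact (Nat.Prime 7) := ⟨by norm_num⟩
  have h7 : (7 : K) = 0 := by simpa using CharP.cast_eq_zero K 7
  have h6 : (6 : K) ≠ 0 := by
    rw [show (6 : K) = 7 - 1 by norm_num, h7, zero_sub]; exact neg_ne_zero.mpr one_ne_zero
  interval_cases d
  · exact iff_of_true (holdsInDegree_zero K) (by decide)
  · exact iff_of_true (holdsInDegree_one (R := K)) (by decide)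
  · exact iff_of_true (holdsInDegree_two (R := K)) (by decide)
  · exact iff_of_true (holdsInDegree_three (K := K) h6) (by decide)
  · exact iff_of_false (not_holdsInDegree_four_of_char_seven (K := K)) (by decide)
  · exact iff_of_false (not_holdsInDegree_five_of_char_seven (K := K)) (by decide)
  · exact iff_of_false (not_holdsInDegree_six_of_charP (K := K) 7 (by norm_num)) (by decide)
  · exact iff_of_true (by simpa using holdsInDegree_prime_pow_field K 7 1) (by decide)

/-- Characteristic 11, `d ≤ 7`: `CA_d(K) ↔ d ≤ 4`. [cite: CastryckLaterveerOunaies2012, Thm. 4] -/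
theorem holdsInDegree_iff_of_char_eleven [CharP K 11] {d : ℕ} (hd : d ≤ 7) :
    HoldsInDegree K d ↔ d ∈ ({0, 1, 2, 3, 4} : Finset ℕ) := by
  haveI : Fact (Nat.Prime 11) := ⟨by norm_num⟩
  interval_cases d
  · exact iff_of_true (holdsInDegree_of_le_four_of_charP K 11 le_rfl (by norm_num)) (by decide)
  · exact iff_of_true (holdsInDegree_of_le_four_of_charP K 11 le_rfl (by norm_num)) (by decide)
  · exact iff_of_true (holdsInDegree_of_le_four_of_charP K 11 le_rfl (by norm_num)) (by decide)
  · exact iff_of_true (holdsInDegree_of_le_four_of_charP K 11 le_rfl (by norm_num)) (by decide)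
  · exact iff_of_true (holdsInDegree_of_le_four_of_charP K 11 le_rfl (by norm_num)) (by decide)
  · exact iff_of_false (not_holdsInDegree_five_of_char_eleven (K := K)) (by decide)
  · exact iff_of_false (not_holdsInDegree_six_of_charP (K := K) 11 (by norm_num)) (by decide)
  · exact iff_of_false (not_holdsInDegree_seven_of_charP (K := K) 11 (by norm_num)) (by decide)

end Literature.Algebra.Polynomial.CasasAlvero
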